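import Summits.QuantumFields.YangMills.Theorems.AlphaInputsT3ACv3SymAvgSixtyNineT3DL
import Summits.QuantumFields.YangMills.Theorems.AlphaInputsT3ACv4RecordSelXs
import HarnessLib

/-!
# `AlphaInputsT3ACv4SmallFactor71OfRecDL` — R3 2′χ (O″χ) B1: **THE v4 SEAM ROW `SmallFactor71OfRecT3` DISCHARGED FOR EVERY ODD `L > 1`** (L-FLOOR LF-2 CLOSED) from the class
# rows of `𝒞_Xs` (read-local (68) + recorded symmetric (67)-largeness) by the (69)_sym chain on LEAD's `d ≤ L` engine, GIVEN only the three displayed record-window numerals —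
# the twin of ✓`…v4SmallFactor71OfRec.smallFactor71OfRecT3_of_windows` WITHOUT `hL5 : 5 ≤ F.L` — lane `pub-balaban3d` ∕ cell `ym3-torus`, seat `ym-ust-19936-w2` (g4),
# ★★OWNER RULING g26-№20 (LF-2) ∕ LEAD ★w1-19936 g3 split (C2)

WHY (★★OWNER RULING g26-№14: R-ii executed at the package by the additive v4 twins; ✓P4 `…v4RecordSelXs` displays the seam row `AlphaInputsT3AC.SmallFactor71OfRecT3`; RULING
g26-№20: its discharge ✓`smallFactor71OfRecT3_of_windows` carried the block-size floor `5 ≤ L` (LF-2) through the k-uniform Prop. 4 of record).  With ✓`…SymAvgSixtyNineT3DL.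
h71_of_recLarge_reg68_dL` (engine ✓`…UniformLgeD`, `d ≤ L`, i.e. every `T3Family`) the floor is gone.  THIS FILE: ★★★ `AlphaInputsT3AC.smallFactor71OfRecT3_of_windows_dL` — at every
`j < K`, `36288000·L²·C68·eps1Of(j) ≤ 1`, `eps1Of(j) ≤ 1`, `½(2C68·C₂(L) + C₂(L)²)·eps1Of(j) ≤ ¼` (`C₂(L) = (11612160000·L² + 1331529∕4)·C68²`) ⟹ `SmallFactor71OfRecT3 F 𝔠 γ hγ hγ1 K`.
The (71)_sym row therefore costs the v4 record exactly three window rows (the lane folds them where `T3Scales_window`∕γ₇₁ live) and NO block-size floor.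
HONEST FRAMING.  A ten-line application; the windows are DISPLAYED, not discharged; nothing here proves NODE O's rows, the selection, the stub `stub_laneRecordsV4Chi`, the crux
`HistoryTailL`, or a mass gap; count-neutral helper (`--supports stmt-QuantumFields-19936`), registry untouched.  YM₃ on T³ is rung R3 of the programme, NOT the Clay problem.

References: T. Bałaban, Commun. Math. Phys. 102 (1985) 255–275 [Balaban1985UV3] ((67)–(71) p.273).
-/

set_option autoImplicit false

noncomputable section

namespace Summit.QuantumFields.YangMills.Theorems

open Literature.MathematicalPhysics.QuantumFieldTheory.Balaban1983to89
open Literature.MathematicalPhysics.QuantumFieldTheory.Balaban1983to89.T3ContinuumYM3Torus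
open Literature.MathematicalPhysics.QuantumFieldTheory.Balaban1985CMP102.Setting
open Summit.QuantumFields.Balaban3D.Carriers
open Summit.QuantumFields.Balaban3D.Proofs.Primitives (AlphaConsts)

section T3

variable {F : T3Family} {𝔠 : AlphaConsts F.L (suGroupModel 2).N} {γ : ℝ} {hγ : 0 < γ} {hγ1 : γ ≤ (min 𝔠.gamma0 1) ^ 2} {K : ℕ}

/-- **★★★ THE v4 SEAM ROW OF RECORD, DISCHARGED MODULO THREE WINDOW NUMERALS, FOR EVERY ODD `L > 1`.**  At every `j < K` assume `36288000·L²·C68·eps1Of(j) ≤ 1`, `eps1Of(j) ≤ 1`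
and `½(2C68·C₂(L) + C₂(L)²)·eps1Of(j) ≤ ¼` with `C₂(L) = (11612160000·L² + 1331529∕4)·C68²`; then `SmallFactor71OfRecT3 F 𝔠 γ hγ hγ1 K` — every member `U₀` of `𝒞_Xs(k, h, W)`
(`k ≤ K`, `h` admissible, any `W`) satisfies the v4 `h71` inequality at every recorded code, by `h71_of_recLarge_reg68_dL` on its `reg68LocalSet` and `large67RecSet` conjuncts
(admissibility, the small-loop conjunct and the charged clause unused).  NO block-size floor. [cite: Balaban1985UV3, (67)–(71) p.273] -/
theorem AlphaInputsT3AC.smallFactor71OfRecT3_of_windows_dL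
    (hwin69 : ∀ j, j < K → 36288000 * (F.L : ℝ) ^ 2 * 𝔠.C68 * eps1Of (T3Scales F γ hγ (hγ1.trans (sq_min_one_le _ 𝔠.gamma0_pos)) K) 𝔠.lane.carrier j ≤ 1)
    (hwin71 : ∀ j, j < K → eps1Of (T3Scales F γ hγ (hγ1.trans (sq_min_one_le _ 𝔠.gamma0_pos)) K) 𝔠.lane.carrier j ≤ 1 ∧
      (2 * 𝔠.C68 * ((11612160000 * (F.L : ℝ) ^ 2 + 1331529 / 4) * 𝔠.C68 ^ 2) + ((11612160000 * (F.L : ℝ) ^ 2 + 1331529 / 4) * 𝔠.C68 ^ 2) ^ 2) / 2 *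
        eps1Of (T3Scales F γ hγ (hγ1.trans (sq_min_one_le _ 𝔠.gamma0_pos)) K) 𝔠.lane.carrier j ≤ 1 / 4) :
    AlphaInputsT3AC.SmallFactor71OfRecT3 F 𝔠 γ hγ hγ1 K := by
  intro k hk h _hh W U₀ hU e he
  obtain ⟨-, hReg, hLarge, -⟩ := hU
  exact AlphaInputsT3AC.h71_of_recLarge_reg68_dL hk h hLarge hReg (fun j hj => hwin69 j (lt_of_lt_of_le hj hk))
    (fun j hj => hwin71 j (lt_of_lt_of_le hj hk)) e he

end T3

end Summit.QuantumFields.YangMills.Theorems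

end
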